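import Summits.HubbardSuperconductivity.HubbardSuperconductivity.Theorems.KacWindowPenaltyGlue
import Literature.MathematicalPhysics.QuantumLattice.PairFieldMomentum
import HarnessLib

/-!
# Crux `WindowInfraredBound` (stmt-HubbardSuperconductivity-1089): what route `KacWindowPenalty` needs of it —
# the infrared LEAK, paired with a UNIFORM-EXCESS window gap (support theorems for the planners)

Route `HubbardSuperconductivity/KacWindowPenalty` closes by `WindowGap → WindowInfraredBound → Target`
(`kacWindowPenalty_targetOfCruxes_proof`) and `Target → HubbardSuperconductivity`
(`kacWindowPenalty_targetImpliesSummit_proof`, both landed in `Theorems/KacWindowPenaltyGlue.lean`). The crux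
`WindowInfraredBound` (`∀ (U,δ) ∃ C ε₀ L₀ ∀ ε ≤ ε₀ … window tail ≤ C ε L²`) enters once, at the `ε ≤ ε₀` that
`WindowGap` returns after seeing `(C, ε₀)`, with `σ := C ε`.

This file records the leak analogue as kernel-checked theorems (no definition is introduced; the hypotheses are
spelled out structurally, the conclusion is the route decl `Target` / the summit):

* `kacTarget_of_uniformWindowGap_of_infraredLeak` — a UNIFORM-EXCESS window gap
  `∃ (U,δ) ∃ a > 0 ∀ ε₀ > 0 ∃ ε ∈ (0, ε₀] ∃ λ > 0 ∃ L₀ ∀ even L ≥ L₀:  λ(a + a)L² ≤ E_L(H_L + λW_ε | K_L) − E_L(H_L | K_L)`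
  (the body of `WindowGap` with `∀ C ∀ ε₀ ∃ ε ∃ λ a` replaced by `∃ a ∀ ε₀ ∃ ε ∃ λ` and the excess `λ(Cε + a)`
  by `λ(a + a)`; `W_ε`, `K_L`, `H_L` verbatim) together with the INFRARED LEAK
  `∀ (U,δ) ∀ b > 0 ∃ ε > 0 ∃ L₀ ∀ even L ≥ L₀ ∀ normalised sector GS ψ: Σ_{m≠0,|q_m|≤ε} ‖Δ_d(m)ψ‖²/L² ≤ b L²`
  (the crux with its linear rate replaced by an arbitrary budget at a budget-dependent window; proved WEAKER
  than the crux: `WindowInfraredBound.infraredLeak_of_windowInfraredBound`, p108857) imply `Target`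
  (with `σ := a`: leak at `b := a` gives `ε_a`; the gap at `ε₀ := ε_a` gives `ε ≤ ε_a`; the tail is monotone
  in the window radius, `kacWindowTail_mono`).
* `kacSummit_of_uniformWindowGap_of_infraredLeak` — hence `HubbardSuperconductivity`
  (`kacWindowPenalty_targetImpliesSummit_proof`).

Planner-facing record (five line leads + two escalated route provers recommended restating the crux as the
leak at the routes' own `(U, δ)`): for THIS route the restatement costs a reshaped gap crux — uniform excess
`2a` at windows of every radius instead of `Cε + a` with `a` chosen after `(C, ε₀)`. Whether that trade is
wanted is a planner decision; this file only certifies that the pair closes the route.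
Sources: D. J. Scalapino, Phys. Rep. 250 (1995) 329, §2 (2.4) [Scalapino1995]; Wang et al., arXiv:2310.05844
§II [WangEtAl2024] (observables from energy sandwiches); Kennedy–Lieb–Shastry, PRL 61 (1988) 2582 [KLS1988PRL].
All folklore logic over the tree's glue.
-/

-- the summit namespace repeats the problem name by design (D-0017)
set_option linter.dupNamespace false

noncomputable section

namespace Summit.HubbardSuperconductivity.HubbardSuperconductivity.Theorems.WindowInfraredBound

open Matrix Finset Literature.MathematicalPhysics.QuantumLattice Literature.Probability.LatticeModels
open Summit.HubbardSuperconductivity.HubbardSuperconductivity.Theses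

/-- **The window tail is monotone in the window radius**: for `0 ≤ ε ≤ ε'` and any Fock vector,
`Σ_{m ≠ 0, |q_m| ≤ ε} S_ψ(m) ≤ Σ_{m ≠ 0, |q_m| ≤ ε'} S_ψ(m)` (termwise, `S_ψ(m) ≥ 0`; literal route form,
`Δ_d(m) = pairFieldAt dWaveFormFactor L m`). [folklore] -/
theorem kacWindowTail_mono (L : ℕ) [NeZero L] (ψ : Fock (Orb (FermionTorus 2 L))) {ε ε' : ℝ}
    (hε : 0 ≤ ε) (hεε' : ε ≤ ε') :
    (∑ m : Fin 2 → ZMod L, if m ≠ 0 ∧ (2 * Real.pi / (L : ℝ)) ^ 2 *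
        (∑ i : Fin 2, (((m i).valMinAbs : ℤ) : ℝ) ^ 2) ≤ ε ^ 2 then
        (star (Matrix.mulVec (pairFieldAt dWaveFormFactor L m) ψ) ⬝ᵥ
          Matrix.mulVec (pairFieldAt dWaveFormFactor L m) ψ).re / (L : ℝ) ^ 2 else 0) ≤
      ∑ m : Fin 2 → ZMod L, if m ≠ 0 ∧ (2 * Real.pi / (L : ℝ)) ^ 2 *
        (∑ i : Fin 2, (((m i).valMinAbs : ℤ) : ℝ) ^ 2) ≤ ε' ^ 2 then
        (star (Matrix.mulVec (pairFieldAt dWaveFormFactor L m) ψ) ⬝ᵥ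
          Matrix.mulVec (pairFieldAt dWaveFormFactor L m) ψ).re / (L : ℝ) ^ 2 else 0 := by
  refine Finset.sum_le_sum fun m _ => ?_
  have hnn : 0 ≤ (star (Matrix.mulVec (pairFieldAt dWaveFormFactor L m) ψ) ⬝ᵥ
      Matrix.mulVec (pairFieldAt dWaveFormFactor L m) ψ).re / (L : ℝ) ^ 2 :=
    pairStructureFactor_nonneg dWaveFormFactor L ψ m
  have hsq : ε ^ 2 ≤ ε' ^ 2 := pow_le_pow_left₀ hε hεε' 2
  split_ifs with h1 h2
  · exact le_rfl
  · exact (h2 ⟨h1.1, h1.2.trans hsq⟩).elim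
  · exact hnn
  · exact le_rfl

/-- **Uniform-excess window gap + infrared leak ⇒ the route target `Target`.** Take `(U, δ, a)` from the gap
hypothesis; the leak at `(U, δ)` with budget `b := a` gives a window `ε_a` and a threshold `L₁` beyond which every
normalised sector ground state has tail `≤ a L²` at radius `ε_a`; the gap hypothesis at `ε₀ := ε_a` gives
`ε ≤ ε_a`, `λ > 0`, `L₀` with `λ(a + a)L² ≤ E_L(H + λW_ε|K) − E_L(H|K)`; `Target` holds with `σ := a` and threshold
`max L₀ L₁`, the tail at radius `ε` being at most the tail at radius `ε_a` (`kacWindowTail_mono`). The `let D` /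
`let W` of `Target` and of the hypotheses are syntactically identical. [folklore] -/
theorem kacTarget_of_uniformWindowGap_of_infraredLeak :
    (∃ U : ℝ, 0 < U ∧ ∃ δ ∈ Set.Ioo (0:ℝ) (1 / 2), ∃ a : ℝ, 0 < a ∧ ∀ ε₀ : ℝ, 0 < ε₀ → ∃ ε ∈ Set.Ioc (0:ℝ) ε₀, ∃ lam : ℝ, 0 < lam ∧ ∃ L₀ : ℕ, ∀ (L : ℕ) [NeZero L], L₀ ≤ L → Even L → let D : (Fin 2 → ZMod L) → Matrix (Finset (Literature.MathematicalPhysics.QuantumLattice.Orb (Literature.MathematicalPhysics.QuantumLattice.FermionTorus 2 L))) (Finset (Literature.MathematicalPhysics.QuantumLattice.Orb (Literature.MathematicalPhysics.QuantumLattice.FermionTorus 2 L))) ℂ := fun m => ∑ x : Fin 2 → ZMod L, Complex.exp (-(2 * Real.pi * Complex.I * (((∑ i : Fin 2, m i * x i).val : ℕ) : ℂ) / (L : ℂ))) • Literature.MathematicalPhysics.QuantumLattice.localPair Literature.MathematicalPhysics.QuantumLattice.dWaveFormFactor L x; let W : Matrix (Finset (Literature.MathematicalPhysics.QuantumLattice.Orb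 (Literature.MathematicalPhysics.QuantumLattice.FermionTorus 2 L))) (Finset (Literature.MathematicalPhysics.QuantumLattice.Orb (Literature.MathematicalPhysics.QuantumLattice.FermionTorus 2 L))) ℂ := ∑ m : Fin 2 → ZMod L, if (2 * Real.pi / (L : ℝ)) ^ 2 * (∑ i : Fin 2, (((m i).valMinAbs : ℤ) : ℝ) ^ 2) ≤ ε ^ 2 then ((L : ℂ) ^ 2)⁻¹ • (Matrix.conjTranspose (D m) * D m) else 0; lam * (a + a) * (L : ℝ) ^ 2 ≤ ((Literature.MathematicalPhysics.QuantumLattice.hubbardTorus 2 L 1 U + (lam : ℂ) • W).minEnergyOn (Literature.MathematicalPhysics.QuantumLattice.szSector (2 * ⌊(1 - δ) * (L : ℝ) ^ 2 / 2⌋₊) 0) - (Literature.MathematicalPhysics.QuantumLattice.hubbardTorus 2 L 1 U).minEnergyOn (Literature.MathematicalPhysics.QuantumLattice.szSector (2 * ⌊(1 - δ) * (L : ℝ) ^ 2 / 2⌋₊) 0))) →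
    (∀ U : ℝ, 0 < U → ∀ δ ∈ Set.Ioo (0:ℝ) (1 / 2), ∀ b : ℝ, 0 < b → ∃ ε : ℝ, 0 < ε ∧ ∃ L₀ : ℕ, ∀ (L : ℕ) [NeZero L], L₀ ≤ L → Even L → let D : (Fin 2 → ZMod L) → Matrix (Finset (Literature.MathematicalPhysics.QuantumLattice.Orb (Literature.MathematicalPhysics.QuantumLattice.FermionTorus 2 L))) (Finset (Literature.MathematicalPhysics.QuantumLattice.Orb (Literature.MathematicalPhysics.QuantumLattice.FermionTorus 2 L))) ℂ := fun m => ∑ x : Fin 2 → ZMod L, Complex.exp (-(2 * Real.pi * Complex.I * (((∑ i : Fin 2, m i * x i).val : ℕ) : ℂ) / (L : ℂ))) • Literature.MathematicalPhysics.QuantumLattice.localPair Literature.MathematicalPhysics.QuantumLattice.dWaveFormFactor L x; ∀ ψ : Literature.MathematicalPhysics.QuantumLattice.Fock (Literature.MathematicalPhysics.QuantumLattice.Orb (Literature.MathematicalPhysics.QuantumLattice.FermionTorus 2 L)), star ψ ⬝ᵥ ψ = 1 → Literature.MathematicalPhysics.QuantumLattice.IsGroundStateInSector (Literature.MathematicalPhysics.QuantumLattice.hubbardTorus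 2 L 1 U) (2 * ⌊(1 - δ) * (L : ℝ) ^ 2 / 2⌋₊) 0 ψ → (∑ m : Fin 2 → ZMod L, if m ≠ 0 ∧ (2 * Real.pi / (L : ℝ)) ^ 2 * (∑ i : Fin 2, (((m i).valMinAbs : ℤ) : ℝ) ^ 2) ≤ ε ^ 2 then (star (Matrix.mulVec (D m) ψ) ⬝ᵥ Matrix.mulVec (D m) ψ).re / (L : ℝ) ^ 2 else 0) ≤ b * (L : ℝ) ^ 2) →
    KacWindowPenalty.Target := by
  rintro ⟨U, hU, δ, hδ, a, ha, hG⟩ hLeak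
  obtain ⟨εa, hεa, L₁, hT⟩ := hLeak U hU δ hδ a ha
  obtain ⟨ε, hε, lam, hlam, L₀, hG⟩ := hG εa hεa
  refine ⟨U, hU, δ, hδ, ε, lam, a, a, hε.1, hlam, ha.le, ha, max L₀ L₁, ?_⟩
  intro L _ hL hEven
  refine ⟨hG L (le_of_max_le_left hL) hEven, fun ψ hψ hGS => ?_⟩
  exact (kacWindowTail_mono L ψ hε.1.le hε.2).trans (hT L (le_of_max_le_right hL) hEven ψ hψ hGS)

/-- **Uniform-excess window gap + infrared leak ⇒ `HubbardSuperconductivity`** — the leak analogue of route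
`KacWindowPenalty`'s Assembly (`kacWindowPenalty_targetImpliesSummit_proof ∘ kacTarget_of_uniformWindowGap_of_infraredLeak`).
[folklore] -/
theorem kacSummit_of_uniformWindowGap_of_infraredLeak :
    (∃ U : ℝ, 0 < U ∧ ∃ δ ∈ Set.Ioo (0:ℝ) (1 / 2), ∃ a : ℝ, 0 < a ∧ ∀ ε₀ : ℝ, 0 < ε₀ → ∃ ε ∈ Set.Ioc (0:ℝ) ε₀, ∃ lam : ℝ, 0 < lam ∧ ∃ L₀ : ℕ, ∀ (L : ℕ) [NeZero L], L₀ ≤ L → Even L → let D : (Fin 2 → ZMod L) → Matrix (Finset (Literature.MathematicalPhysics.QuantumLattice.Orb (Literature.MathematicalPhysics.QuantumLattice.FermionTorus 2 L))) (Finset (Literature.MathematicalPhysics.QuantumLattice.Orb (Literature.MathematicalPhysics.QuantumLattice.FermionTorus 2 L))) ℂ := fun m => ∑ x : Fin 2 → ZMod L, Complex.exp (-(2 * Real.pi * Complex.I * (((∑ i : Fin 2, m i * x i).val : ℕ) : ℂ) / (L : ℂ))) • Literature.MathematicalPhysics.QuantumLattice.localPair Literature.MathematicalPhysics.QuantumLattice.dWaveFormFactor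 L x; let W : Matrix (Finset (Literature.MathematicalPhysics.QuantumLattice.Orb (Literature.MathematicalPhysics.QuantumLattice.FermionTorus 2 L))) (Finset (Literature.MathematicalPhysics.QuantumLattice.Orb (Literature.MathematicalPhysics.QuantumLattice.FermionTorus 2 L))) ℂ := ∑ m : Fin 2 → ZMod L, if (2 * Real.pi / (L : ℝ)) ^ 2 * (∑ i : Fin 2, (((m i).valMinAbs : ℤ) : ℝ) ^ 2) ≤ ε ^ 2 then ((L : ℂ) ^ 2)⁻¹ • (Matrix.conjTranspose (D m) * D m) else 0; lam * (a + a) * (L : ℝ) ^ 2 ≤ ((Literature.MathematicalPhysics.QuantumLattice.hubbardTorus 2 L 1 U + (lam : ℂ) • W).minEnergyOn (Literature.MathematicalPhysics.QuantumLattice.szSector (2 * ⌊(1 - δ) * (L : ℝ) ^ 2 / 2⌋₊) 0) - (Literature.MathematicalPhysics.QuantumLattice.hubbardTorus 2 L 1 U).minEnergyOn (Literature.MathematicalPhysics.QuantumLattice.szSector (2 * ⌊(1 - δ) * (L : ℝ) ^ 2 / 2⌋₊) 0))) →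
    (∀ U : ℝ, 0 < U → ∀ δ ∈ Set.Ioo (0:ℝ) (1 / 2), ∀ b : ℝ, 0 < b → ∃ ε : ℝ, 0 < ε ∧ ∃ L₀ : ℕ, ∀ (L : ℕ) [NeZero L], L₀ ≤ L → Even L → let D : (Fin 2 → ZMod L) → Matrix (Finset (Literature.MathematicalPhysics.QuantumLattice.Orb (Literature.MathematicalPhysics.QuantumLattice.FermionTorus 2 L))) (Finset (Literature.MathematicalPhysics.QuantumLattice.Orb (Literature.MathematicalPhysics.QuantumLattice.FermionTorus 2 L))) ℂ := fun m => ∑ x : Fin 2 → ZMod L, Complex.exp (-(2 * Real.pi * Complex.I * (((∑ i : Fin 2, m i * x i).val : ℕ) : ℂ) / (L : ℂ))) • Literature.MathematicalPhysics.QuantumLattice.localPair Literature.MathematicalPhysics.QuantumLattice.dWaveFormFactor L x; ∀ ψ : Literature.MathematicalPhysics.QuantumLattice.Fock (Literature.MathematicalPhysics.QuantumLattice.Orb (Literature.MathematicalPhysics.QuantumLattice.FermionTorus 2 L)), star ψ ⬝ᵥ ψ = 1 → Literature.MathematicalPhysics.QuantumLattice.IsGroundStateInSector (Literature.MathematicalPhysics.QuantumLattice.hubbardTorus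 2 L 1 U) (2 * ⌊(1 - δ) * (L : ℝ) ^ 2 / 2⌋₊) 0 ψ → (∑ m : Fin 2 → ZMod L, if m ≠ 0 ∧ (2 * Real.pi / (L : ℝ)) ^ 2 * (∑ i : Fin 2, (((m i).valMinAbs : ℤ) : ℝ) ^ 2) ≤ ε ^ 2 then (star (Matrix.mulVec (D m) ψ) ⬝ᵥ Matrix.mulVec (D m) ψ).re / (L : ℝ) ^ 2 else 0) ≤ b * (L : ℝ) ^ 2) →
    _root_.HubbardSuperconductivity := fun hG hL =>
  kacWindowPenalty_targetImpliesSummit_proof (kacTarget_of_uniformWindowGap_of_infraredLeak hG hL)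

end Summit.HubbardSuperconductivity.HubbardSuperconductivity.Theorems.WindowInfraredBound

end
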